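import Literature.MathematicalPhysics.QuantumFieldTheory.Balaban1983to89.Beta.ColourWordMatrices
import Summits.QuantumFields.BalabanUV.Beta.ColourBasisSU

/-!
# `BalabanUV.Beta.FP.TadpoleAdInvarianceColour` — road «FP» for binder row D1, organisation γ, sub-row **GAMMA-0c (S4-AD), item (i)**
# (owner d1-p3-g7, journal l.24514 (E)): THE COLOUR LETTER — a complete generator family has TRIVIAL CENTRALISER (Schur from the
# Fierz identity), hence «NO ad-INVARIANT VECTOR» `(∀ b, A_b·x = 0) → x = 0` and «NO ad-INVARIANT COVECTOR» `(∀ b, t·A_b = 0) → t = 0`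
# in the structure-constant currency `A_b = adMat τ (τ b)`; instances `su(N)` for EVERY `N` (an3's `suGen`) and `su(2)` (lit1's `pauli`)
# with no hypothesis left (the `ε_{abc}` spelling over `GhostTable.adPauli` is the companion `FP/TadpoleAdInvarianceColourSU2`)

HONEST DEPENDENCY (page 1, mandatory): continuum YM on T⁴ ⇐ BetaPertH ∧ nine spine estimates (0/9 proved); BetaPertH ⇐ (D1) ∧ (D4) ∧
CAP+tail; G-an2-4 gates asym, D1 and NE2/3/4.  HONEST FRAMING (cell contract, verbatim): «discharging `BetaPertH` makes Bałaban's UV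
stability UNCONDITIONAL — a real constructive-QFT result; it is NOT the continuum limit and NOT the Clay problem.»  THIS MODULE DISCHARGES
NOTHING of the wall: it is [folklore] finite-dimensional linear algebra over lit1's `Beta.ColourTrace` (`Complete`, `TrOrthonormal`, `adMatC`,
`adMat`, `sandwich`, `ibr_gen_eq_sum`, `adMatC_antisymm`, `adMat_coe`, `trace_gen_eq_zero`, `pauli…`), lit1's `ColourWordMatrices.coord_unique`
and an3's `Beta.ColourBasisSU` (`suGen_complete`, `suGen_trOrthonormal`, `suGen_isHermitian`) BY NAME.
No `def`, no `def … : Prop`, nothing cited, 0 sorry; 0 estimates; 0∕4 row-D1 binders; NOT D1, NOT BetaPertH, NOT continuum, NOT Clay.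

ABSOLUTE RULE (cell charter, verbatim): «No internally-minted statement may enter as a cited fact. Every hypothesis is either kernel-proved
in this package or a verbatim quotation of a PUBLISHED theorem with page reference. The manuscript(s) under audit are NOT citable for their
own disputed steps — they are the thing under adjudication; programme-internal (2001/route/tribunal) claims are never citable.»

THE SUB-ROW (owner d1-p3-g7, l.24514 (E), verbatim up to notation): «the road discharge of the displayed tadpole hypothesis `htad` of
GAMMA-0 (a)∕(b) is NOT colour parity alone … but GLOBAL COLOUR (Ad) INVARIANCE + SEMISIMPLICITY: (i) [folklore] `∀ c ∈ su(N), N ≥ 2,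
(∀ g ∈ SU(N), g c g⁻¹ = c) → c = 0` (no Ad-invariant vector; in an3's structure-constant currency: `(∀ b, Σ_c f_{abc} x_c = 0 ∀ a) → x = 0`
for a colour table with trivial centre — state it over the tree's colour data with the non-degeneracy letter DISPLAYED, instance SU(2) =
`ε_{abc}` …); (ii) model … ; (iii) …».  Items (ii)+(iii) are beta-d1-formalise-leaf-05-g11's `FP/TadpoleAdInvariance` (l.24543); THIS FILE is
item (i), in the INFINITESIMAL ∕ structure-constant form that (ii)+(iii) consume — and the «trivial centre» letter is not displayed but PROVED
from completeness.  The GROUP statement `∀ g ∈ SU(N), gcg⁻¹ = c` as such (passage group → algebra for a concrete representation `ρ`) is NOT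
here; `U(1)` has no such letter (owner: reflection substitute, not this road).

CONTENT (all [folklore]; `τ : C → Mat_N(ℂ)` a generator family, `A_b := adMatC τ (τ b)` — for Hermitian generators the real matrix
`adMat τ (τ b)`, the structure constants of lit1's `ColourTraceAdjoint.letter_comm_gen_eq_sum` «`[t_b, t_c] = Σ_a (A_b)_{ac}·t_a`»):
§1 SCHUR FROM FIERZ.  `sum_gen_mul_gen` (`Σ_c τ_c² = (N²−1)·1` for a complete family); **`natCast_smul_eq_trace_smul_one_of_forall_comm`** —
   `Complete τ`, `N ≠ 0`, `X` commuting with every `τ_d` ⟹ `N•X = (Tr X)•1` (`sandwich`: `Σ_c τ_cXτ_c = (N·Tr X)•1 − X`); hence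
   **`eq_zero_of_forall_comm_of_trace_eq_zero`** — the traceless part of the centraliser is `0`: the centre of `su(N)` ∕ `sl_N` is trivial.
§2 STRUCTURE-CONSTANT FORM («no ad-invariant vector»).  `ibr_sum_smul` (linearity); **`coord_eq_zero_of_adMatC_mulVec_eq_zero`** —
   `Complete τ`, `TrOrthonormal τ`, `N ≠ 0`: `(∀ b, A_b *ᵥ x = 0) → x = 0` for `x : C → ℂ`; **`coord_eq_zero_of_adMat_mulVec_eq_zero`** — the
   same over `ℝ` for Hermitian generators.
§3 «NO ad-INVARIANT COVECTOR» (the dual letter, by antisymmetry of `A_b`): **`covector_eq_zero_of_vecMul_adMat_eq_zero`** —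
   `(∀ b, t ᵥ* A_b = 0) → t = 0` for `t : C → ℝ`.
§4 INSTANCES WITH NO HYPOTHESIS LEFT.  **`coord_eq_zero_of_adMat_suGen_mulVec_eq_zero`** ∕ **`covector_eq_zero_of_vecMul_adMat_suGen_eq_zero`**
   (`su(N)`, every `N ≠ 0`, an3's family of record `suGen N`); **`coord_eq_zero_of_adMat_pauli_mulVec_eq_zero`** (`su(2)`, lit1's `pauli`).  The `ε_{abc}`
   spelling (`GhostTable.adPauli`, `(∀ b d, Σ_c ε_{bcd} x_c = 0) → x = 0`) is the companion `FP/TadpoleAdInvarianceColourSU2` (split off: `GhostTable`'s import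
   cone is heavy).
§5 THE LETTER `hno` OF (ii)+(iii) FROM (i).  `eq_dotProduct_of_additive_homogeneous`; **`noInvariantCovector_of_adVelocities`** — for ANY family of maps
   `ρ : G → (C → ℝ) → (C → ℝ)` containing, for every generator `b` and vector `w`, a curve with velocity `A_b *ᵥ w` at `0` (the adjoint one-parameter
   groups of the road's colour rotations — DISPLAYED, not constructed here), every additive homogeneous `ρ`-invariant functional vanishes: VERBATIM the
   hypothesis `hno` of leaf-05-g11's `TadpoleAdInvariance.tadpole_eq_zero_of_noInvariantCovector` (p244172).
Provenance: cross-cell idle seat b2b-balaban-t4-ne7b-formalise-leaf-09 (gen 20, prover-b2b-balaban-t4-ne7b-formalise-leaf-09-g20-0) for road FP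
owner b2b-balaban-beta-d1-p3, 2026-08-21 (sub-row GAMMA-0c item (i); journal INTENT «GAMMA-0c (i)» l.24668, first refusal exercised).  [folklore],
0 def, 0 cite, 0 sorry.
-/

noncomputable section

namespace Summit.QuantumFields.BalabanUV.Beta.FP.TadpoleAdInvarianceColour

open Matrix Finset
open scoped BigOperators Matrix
open Literature.MathematicalPhysics.QuantumFieldTheory.Balaban1983to89.B9AdOrthogonal (GMIndex)
open Literature.MathematicalPhysics.QuantumFieldTheory.Balaban1983to89.Beta.ColourTrace
  (ibr adMatC adMat Complete TrOrthonormal sandwich ibr_gen_eq_sum adMatC_antisymm adMat_apply adMat_coe adMat_transpose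
    trace_gen_eq_zero pauli pauli_complete pauli_trOrthonormal pauli_isHermitian)
open Literature.MathematicalPhysics.QuantumFieldTheory.Balaban1983to89.Beta.ColourWordMatrices (coord_unique)
open Summit.QuantumFields.BalabanUV.Beta.ColourBasisSU (suGen suGen_complete suGen_trOrthonormal suGen_isHermitian)

variable {N : ℕ} {C : Type*} [Fintype C]

/-! ## §1 Schur from Fierz: the centraliser of a complete family is the scalars -/

section Schur

/-- [folklore] For a complete family, `Σ_c τ_c·τ_c = (N² − 1)•1` (`sandwich` at `M = 1`). -/
theorem sum_gen_mul_gen {τ : C → Matrix (Fin N) (Fin N) ℂ} (hτ : Complete τ) :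
    ∑ c, τ c * τ c = ((N : ℂ) * N) • (1 : Matrix (Fin N) (Fin N) ℂ) - 1 := by
  have h := sandwich hτ (1 : Matrix (Fin N) (Fin N) ℂ)
  simp only [Matrix.mul_one, Matrix.trace_one, Fintype.card_fin] at h
  exact h

/-- [folklore] **SCHUR FROM FIERZ**: if `τ` is complete, `N ≠ 0` and `X` commutes with every generator, then `N•X = (Tr X)•1` — the centraliser
of a complete family inside `Mat_N(ℂ)` is the scalars.  (`Σ_c τ_cXτ_c` computed twice: by `sandwich` it is `(N·Tr X)•1 − X`, by commuting `X`
through it is `(Σ_c τ_c²)·X = (N²−1)•X`.) -/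
theorem natCast_smul_eq_trace_smul_one_of_forall_comm {τ : C → Matrix (Fin N) (Fin N) ℂ} (hτ : Complete τ) (hN : N ≠ 0)
    {X : Matrix (Fin N) (Fin N) ℂ} (hX : ∀ d, X * τ d = τ d * X) :
    (N : ℂ) • X = X.trace • (1 : Matrix (Fin N) (Fin N) ℂ) := by
  have h1 := sandwich hτ X
  have h2 : ∑ c, τ c * X * τ c = (∑ c, τ c * τ c) * X := by
    rw [Finset.sum_mul]
    refine Finset.sum_congr rfl fun c _ => ?_
    rw [Matrix.mul_assoc, hX c, ← Matrix.mul_assoc]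
  rw [h2, sum_gen_mul_gen hτ, Matrix.sub_mul, Matrix.smul_mul, Matrix.one_mul, mul_smul, mul_smul] at h1
  have h3 : (N : ℂ) • ((N : ℂ) • X) = (N : ℂ) • (X.trace • (1 : Matrix (Fin N) (Fin N) ℂ)) := sub_left_injective h1
  exact smul_right_injective _ (Nat.cast_ne_zero.mpr hN) h3

/-- [folklore] **TRIVIAL CENTRE**: a TRACELESS matrix commuting with every generator of a complete family is `0` — the centre of `su(N)` ∕ `sl_N`
is trivial (the «non-degeneracy letter» of the owner's item (i), PROVED rather than displayed). -/
theorem eq_zero_of_forall_comm_of_trace_eq_zero {τ : C → Matrix (Fin N) (Fin N) ℂ} (hτ : Complete τ) (hN : N ≠ 0)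
    {X : Matrix (Fin N) (Fin N) ℂ} (hX : ∀ d, X * τ d = τ d * X) (htr : X.trace = 0) : X = 0 := by
  have h := natCast_smul_eq_trace_smul_one_of_forall_comm hτ hN hX
  rw [htr, zero_smul] at h
  exact (smul_eq_zero.mp h).resolve_left (Nat.cast_ne_zero.mpr hN)

end Schur

/-! ## §2 The structure-constant form: no ad-invariant vector -/

section Vector

omit [Fintype C] in
/-- [folklore] `i[Y, ·]` is linear: `i[Y, Σ_d x_d τ_d] = Σ_d x_d·i[Y, τ_d]`. -/
theorem ibr_sum_smul (Y : Matrix (Fin N) (Fin N) ℂ) (τ : C → Matrix (Fin N) (Fin N) ℂ) (s : Finset C) (x : C → ℂ) :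
    ibr Y (∑ d ∈ s, x d • τ d) = ∑ d ∈ s, x d • ibr Y (τ d) := by
  unfold ibr
  rw [Matrix.mul_sum, Matrix.sum_mul, ← Finset.sum_sub_distrib, Finset.smul_sum]
  refine Finset.sum_congr rfl fun d _ => ?_
  rw [Matrix.mul_smul, Matrix.smul_mul, ← smul_sub, smul_comm]

/-- [folklore] **NO ad-INVARIANT VECTOR** (the owner's «`(∀ a b, Σ_c f_{abc}x_c = 0) → x = 0`» in the tree's currency): for a complete,
tr-orthonormal family with `N ≠ 0` and `x : C → ℂ`, if `A_b *ᵥ x = 0` for every `b` (`A_b = adMatC τ (τ b)`), then `x = 0`.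
(`X := Σ_c x_cτ_c` satisfies `i[τ_b, X] = Σ_a (A_b *ᵥ x)_a τ_a = 0` by `ibr_gen_eq_sum`, is traceless by `trace_gen_eq_zero`, hence `X = 0` by §1,
hence `x = 0` by `coord_unique`.) -/
theorem coord_eq_zero_of_adMatC_mulVec_eq_zero [DecidableEq C] {τ : C → Matrix (Fin N) (Fin N) ℂ} (hτ : Complete τ)
    (ho : TrOrthonormal τ) (hN : N ≠ 0) {x : C → ℂ} (h : ∀ b, adMatC τ (τ b) *ᵥ x = 0) : x = 0 := by
  set X : Matrix (Fin N) (Fin N) ℂ := ∑ d, x d • τ d with hXdef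
  -- `i[τ_b, X] = 0`
  have hibr : ∀ b, ibr (τ b) X = 0 := by
    intro b
    rw [hXdef, ibr_sum_smul]
    simp_rw [ibr_gen_eq_sum hτ hN (τ b), Finset.smul_sum, smul_smul]
    rw [Finset.sum_comm]
    have hx : ∀ a, ∑ d, (x d * adMatC τ (τ b) a d) • τ a = (adMatC τ (τ b) *ᵥ x) a • τ a := by
      intro a
      rw [← Finset.sum_smul, Matrix.mulVec, dotProduct]
      congr 1
      exact Finset.sum_congr rfl fun d _ => mul_comm _ _
    simp only [hx, h b, Pi.zero_apply, zero_smul, Finset.sum_const_zero]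
  -- hence `X` commutes with every generator
  have hcomm : ∀ d, X * τ d = τ d * X := by
    intro d
    have h0 := hibr d
    unfold ibr at h0
    rw [smul_eq_zero, sub_eq_zero] at h0
    exact (h0.resolve_left Complex.I_ne_zero).symm
  -- `X` is traceless
  have htr : X.trace = 0 := by
    rw [hXdef, Matrix.trace_sum]
    simp [Matrix.trace_smul, trace_gen_eq_zero hτ ho hN]
  have hX0 : X = 0 := eq_zero_of_forall_comm_of_trace_eq_zero hτ hN hcomm htr
  -- read off the coordinates
  refine coord_unique ho hN (y := 0) ?_
  have e : ∑ a, x a • (Complex.I • τ a) = Complex.I • X := by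
    rw [hXdef, Finset.smul_sum]
    exact Finset.sum_congr rfl fun a _ => smul_comm _ _ _
  rw [e, hX0, smul_zero]
  simp

/-- [folklore] **NO ad-INVARIANT VECTOR, REAL FORM** (Hermitian generators, the real structure constants `adMat`): `(∀ b, adMat τ (τ b) *ᵥ x = 0) → x = 0`
for `x : C → ℝ`. -/
theorem coord_eq_zero_of_adMat_mulVec_eq_zero [DecidableEq C] {τ : C → Matrix (Fin N) (Fin N) ℂ} (hτ : Complete τ)
    (ho : TrOrthonormal τ) (hH : ∀ c, (τ c).IsHermitian) (hN : N ≠ 0) {x : C → ℝ} (h : ∀ b, adMat τ (τ b) *ᵥ x = 0) :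
    x = 0 := by
  have hc : (fun c => (x c : ℂ)) = 0 := by
    refine coord_eq_zero_of_adMatC_mulVec_eq_zero hτ ho hN fun b => ?_
    funext a
    have ha := congrFun (h b) a
    simp only [Matrix.mulVec, dotProduct, Pi.zero_apply] at ha ⊢
    rw [Finset.sum_congr rfl fun c _ => by rw [← adMat_coe hH (hH b) a c]]
    exact_mod_cast ha
  funext c
  have := congrFun hc c
  simpa using this

end Vector

/-! ## §3 The dual letter: no ad-invariant covector -/

section Covector

/-- [folklore] **NO ad-INVARIANT COVECTOR** (perfectness `𝔤 = [𝔤, 𝔤]` in coordinates; the letter leaf-05's `hno` consumes): for Hermitian, complete,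
tr-orthonormal generators with `N ≠ 0`, a real covector `t` with `t ᵥ* adMat τ (τ b) = 0` for every `b` is `0` (antisymmetry `A_bᵀ = −A_b` turns it into
§2). -/
theorem covector_eq_zero_of_vecMul_adMat_eq_zero [DecidableEq C] {τ : C → Matrix (Fin N) (Fin N) ℂ} (hτ : Complete τ)
    (ho : TrOrthonormal τ) (hH : ∀ c, (τ c).IsHermitian) (hN : N ≠ 0) {t : C → ℝ} (h : ∀ b, t ᵥ* adMat τ (τ b) = 0) :
    t = 0 := by
  refine coord_eq_zero_of_adMat_mulVec_eq_zero hτ ho hH hN fun b => ?_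
  rw [← Matrix.vecMul_transpose, adMat_transpose, Matrix.vecMul_neg, h b, neg_zero]

end Covector

/-! ## §4 Instances with no hypothesis left: `su(N)` for every `N`, and `su(2)` -/

section Instances

/-- [folklore] **`su(N)` HAS NO ad-INVARIANT VECTOR**, every `N ≠ 0`, over an3's colour family of record `suGen N` (complete ✓, tr-orthonormal ✓,
Hermitian ✓ in the tree): `(∀ b, adMat (suGen N) (suGen N b) *ᵥ x = 0) → x = 0`. -/
theorem coord_eq_zero_of_adMat_suGen_mulVec_eq_zero (hN : N ≠ 0) {x : GMIndex N → ℝ}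
    (h : ∀ b, adMat (suGen N) (suGen N b) *ᵥ x = 0) : x = 0 :=
  coord_eq_zero_of_adMat_mulVec_eq_zero (suGen_complete hN) (suGen_trOrthonormal N) suGen_isHermitian hN h

/-- [folklore] **`su(N)` HAS NO ad-INVARIANT COVECTOR**, every `N ≠ 0`: `(∀ b, t ᵥ* adMat (suGen N) (suGen N b) = 0) → t = 0`. -/
theorem covector_eq_zero_of_vecMul_adMat_suGen_eq_zero (hN : N ≠ 0) {t : GMIndex N → ℝ}
    (h : ∀ b, t ᵥ* adMat (suGen N) (suGen N b) = 0) : t = 0 :=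
  covector_eq_zero_of_vecMul_adMat_eq_zero (suGen_complete hN) (suGen_trOrthonormal N) suGen_isHermitian hN h

/-- [folklore] **`su(2)` IN THE PAULI FAMILY**: `(∀ b, adMat pauli (pauli b) *ᵥ x = 0) → x = 0` (lit1's `pauli_complete` ✓, `pauli_trOrthonormal` ✓,
`pauli_isHermitian` ✓). -/
theorem coord_eq_zero_of_adMat_pauli_mulVec_eq_zero {x : Fin 3 → ℝ} (h : ∀ b, adMat pauli (pauli b) *ᵥ x = 0) : x = 0 :=
  coord_eq_zero_of_adMat_mulVec_eq_zero pauli_complete pauli_trOrthonormal pauli_isHermitian two_ne_zero h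

end Instances

/-! ## §5 From one-parameter families with adjoint velocities to the letter `hno` of GAMMA-0c (ii)+(iii) -/

section NoInvariantCovector

open Topology

/-- [folklore] An additive, homogeneous real functional on `C → ℝ` is the dot product with its values on the coordinate vectors. -/
theorem eq_dotProduct_of_additive_homogeneous (T : (C → ℝ) → ℝ) (hadd : ∀ w w', T (w + w') = T w + T w')
    (hsmul : ∀ (r : ℝ) w, T (r • w) = r * T w) [DecidableEq C] (v : C → ℝ) :
    T v = (fun c => T (Pi.single c 1)) ⬝ᵥ v := by
  let Tₗ : (C → ℝ) →ₗ[ℝ] ℝ := { toFun := T, map_add' := hadd, map_smul' := fun r w => by simpa using hsmul r w }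
  have hv : v = ∑ c, v c • (Pi.single c (1 : ℝ) : C → ℝ) := by
    conv_lhs => rw [← Finset.univ_sum_single v]
    refine Finset.sum_congr rfl fun c _ => ?_
    rw [← Pi.single_smul', smul_eq_mul, mul_one]
  have hL : Tₗ v = ∑ c, v c * Tₗ (Pi.single c 1) := by
    conv_lhs => rw [hv]
    rw [map_sum]
    exact Finset.sum_congr rfl fun c _ => by rw [map_smul, smul_eq_mul]
  change Tₗ v = _
  rw [hL, dotProduct]
  exact Finset.sum_congr rfl fun c _ => by rw [mul_comm]; rfl

/-- [folklore] **THE LETTER `hno` OF GAMMA-0c (ii)+(iii) FROM ITEM (i)**: let `τ` be Hermitian, complete, tr-orthonormal, `N ≠ 0`, and let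
`ρ : G → (C → ℝ) → (C → ℝ)` be ANY family of maps (on the road: the global colour rotations in coordinates) such that for every generator `b` and
every `w` some curve `s ↦ ρ (g s) w` in the family has VELOCITY `adMat τ (τ b) *ᵥ w` at `s = 0` (the adjoint one-parameter groups; displayed, not
constructed here).  Then every additive homogeneous `ρ`-invariant real functional on `C → ℝ` vanishes — verbatim the hypothesis `hno` of
leaf-05-g11's `TadpoleAdInvariance.tadpole_eq_zero_of_noInvariantCovector`.  (Invariance makes `s ↦ T(ρ (g s) w)` constant; its derivative at `0` is
`T(A_b w) = (t ᵥ* A_b) ⬝ᵥ w` with `t_c = T(e_c)`; so `t ᵥ* A_b = 0` for all `b`, and `t = 0` by §3.) -/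
theorem noInvariantCovector_of_adVelocities [DecidableEq C] {τ : C → Matrix (Fin N) (Fin N) ℂ} (hτ : Complete τ)
    (ho : TrOrthonormal τ) (hH : ∀ c, (τ c).IsHermitian) (hN : N ≠ 0) {G : Type*} (ρ : G → (C → ℝ) → (C → ℝ))
    (hcurve : ∀ (b : C) (w : C → ℝ), ∃ g : ℝ → G, HasDerivAt (fun s => ρ (g s) w) (adMat τ (τ b) *ᵥ w) 0) :
    ∀ T : (C → ℝ) → ℝ, (∀ w w', T (w + w') = T w + T w') → (∀ (r : ℝ) w, T (r • w) = r * T w) →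
      (∀ g w, T (ρ g w) = T w) → ∀ w, T w = 0 := by
  intro T hadd hsmul hinv w
  set t : C → ℝ := fun c => T (Pi.single c 1) with ht_def
  have hT : ∀ v, T v = t ⬝ᵥ v := eq_dotProduct_of_additive_homogeneous T hadd hsmul
  -- `t ᵥ* A_b = 0` for every generator `b`
  have hvec : ∀ b, t ᵥ* adMat τ (τ b) = 0 := by
    intro b
    -- `(t ᵥ* A_b) ⬝ᵥ w' = 0` for every `w'`
    have hw : ∀ w' : C → ℝ, (t ᵥ* adMat τ (τ b)) ⬝ᵥ w' = 0 := by
      intro w'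
      obtain ⟨g, hg⟩ := hcurve b w'
      have hderiv : HasDerivAt (fun s => T (ρ (g s) w')) (t ⬝ᵥ (adMat τ (τ b) *ᵥ w')) 0 := by
        have hc : ∀ c ∈ (Finset.univ : Finset C),
            HasDerivAt (fun s => t c * ρ (g s) w' c) (t c * (adMat τ (τ b) *ᵥ w') c) 0 :=
          fun c _ => ((hasDerivAt_pi.1 hg) c).const_mul (t c)
        have hs := HasDerivAt.sum hc
        have hfun : (fun s => T (ρ (g s) w')) = ∑ c ∈ (Finset.univ : Finset C), fun s => t c * ρ (g s) w' c := by
          funext s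
          rw [hT, Finset.sum_apply]
          rfl
        rw [hfun]
        exact hs
      have hconst : HasDerivAt (fun s => T (ρ (g s) w')) 0 0 := by
        have : (fun s => T (ρ (g s) w')) = fun _ => T w' := funext fun s => hinv (g s) w'
        rw [this]
        exact hasDerivAt_const 0 (T w')
      have h0 : t ⬝ᵥ (adMat τ (τ b) *ᵥ w') = 0 := hderiv.unique hconst
      rwa [Matrix.dotProduct_mulVec] at h0
    funext c
    have h := hw (Pi.single c 1)
    rwa [dotProduct_single, mul_one] at h
  have ht : t = 0 := covector_eq_zero_of_vecMul_adMat_eq_zero hτ ho hH hN hvec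
  rw [hT w, ht, zero_dotProduct]

end NoInvariantCovector

end Summit.QuantumFields.BalabanUV.Beta.FP.TadpoleAdInvarianceColour

end
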